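import Literature.MathematicalPhysics.QuantumFieldTheory.FinTorusPlaquetteSystem
import HarnessLib

/-!
# The `2 : 1` time covering of 't Hooft boxes `n₀ × n₁ × n₂ × 2n → n₀ × n₁ × n₂ × n`: cyclic time distance, the fold, its local
# sections, and injectivity on time balls

Topic `Literature/MathematicalPhysics/QuantumFieldTheory`; vocabulary of `WilsonFinTorusPartition.lean` (`FinTorusSite`, `FinTorusSite.shift` =
`finRotate` in one coordinate, `finTorusPlaquette`) and `FinTorusPlaquetteSystem.lean` (`FinTorusPlaquette`, `FinTorusLink`, `finTorusPlaqEdges`,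
`finTorusSystem`).  DEFINITIONS with elementary API (lattice geometry only; dw-p1 / planner ym-idea-4 RUNG-PLAN-K2 step K2-b «lifting lemma» for
LINE g21-A `MagneticFluxCeiling`: the covering map of the torus of time period `2n` onto the torus of period `n` is injective on every time ball
of radius `R` with `2R < n`, so small clusters of the two boxes correspond).  The box of period `2n` is written `n + n` (so that no numeral
enters the index types).

* `finCycDist a b` — the cyclic distance on `Fin m` (`min(|a-b|, m-|a-b|)`): symmetric, triangle inequality, `1`-Lipschitz under `finRotate`;
* `finFold : Fin (n+n) → Fin n` (`t ↦ t mod n`), `finFold_finRotate` (a covering of cycle graphs), `eq_of_finFold_eq` (injective on pairs at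
  cyclic distance `< n`); `finLift t₀ : Fin n → Fin (n+n)` — the preimage cyclically closer to `t₀` (`finFold_finLift`, `finCycDist_finLift`,
  `finLift_finFold`);
* `siteFold`, `linkFold`, `plaqFold` — the covering on sites/links/plaquettes, commuting with the shifts (`siteFold_shift`), mapping the links
  of a plaquette onto the links of its image (`finTorusPlaqEdges_plaqFold`) and pulling back plaquette variables (`finTorusPlaquette_comp_linkFold`);
  `siteLift`, `plaqLift` — the local sections (`plaqFold_plaqLift`, `plaqLift_plaqFold`);
* time coordinates along links (`time_of_mem_finTorusPlaqEdges`, `finCycDist_le_one_of_linkRel`, `finCycDist_lipschitz_linkRel`: the time distance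
  to a base time is `1`-Lipschitz along the link-sharing relation) and ★ injectivity of the covering on time balls of radius `R`, `2R < n`, for
  plaquettes (`plaqFold_injOn_ball`) and for the links of such plaquettes (`linkFold_injOn_ball`).

HONEST FRAMING: finite lattice geometry; no analysis.  Consumed by `FinTorusAspectComparison.lean`.
-/

noncomputable section

open Finset

namespace Literature.MathematicalPhysics.QuantumFieldTheory

/-! ### Cyclic distance on `Fin m`, the `2 : 1` fold `Fin (2n) → Fin n` and its local sections -/

/-- **Cyclic distance** on `Fin m` (`ℤ/m` as a cycle graph): `min (|a - b|, m - |a - b|)`. [cite: SeilerLNP1982, Ch. 2] -/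
def finCycDist {m : ℕ} (a b : Fin m) : ℕ :=
  min (max a.val b.val - min a.val b.val) (m - (max a.val b.val - min a.val b.val))

/-- The cyclic distance from a point to itself is `0`. [cite: SeilerLNP1982, Ch. 2] -/
theorem finCycDist_self {m : ℕ} (a : Fin m) : finCycDist a a = 0 := by
  unfold finCycDist; omega

/-- The cyclic distance is symmetric. [cite: SeilerLNP1982, Ch. 2] -/
theorem finCycDist_comm {m : ℕ} (a b : Fin m) : finCycDist a b = finCycDist b a := by
  unfold finCycDist; omega

/-- Triangle inequality for the cyclic distance. [cite: SeilerLNP1982, Ch. 2] -/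
theorem finCycDist_triangle {m : ℕ} (a b c : Fin m) : finCycDist a c ≤ finCycDist a b + finCycDist b c := by
  have ha := a.isLt; have hb := b.isLt; have hc := c.isLt
  unfold finCycDist; omega

/-- The cyclic distance is at most half the period. [cite: SeilerLNP1982, Ch. 2] -/
theorem two_mul_finCycDist_le {m : ℕ} (a b : Fin m) : 2 * finCycDist a b ≤ m := by
  have ha := a.isLt; have hb := b.isLt
  unfold finCycDist; omega

/-- The value of `finRotate`: `t + 1`, wrapping to `0` at the top. [cite: SeilerLNP1982, Ch. 2] -/
theorem val_finRotate {m : ℕ} (t : Fin m) :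
    ((finRotate m t : Fin m) : ℕ) = (if (t : ℕ) + 1 = m then 0 else (t : ℕ) + 1 : ℕ) := by
  cases m with
  | zero => exact t.elim0
  | succ k =>
    rw [coe_finRotate]
    by_cases h : t = Fin.last k
    · subst h
      simp
    · have hne : (t : ℕ) ≠ k := fun h' => h (Fin.ext (by rw [h', Fin.val_last]))
      rw [if_neg h, if_neg (by omega)]

/-- One step of `finRotate` increases the cyclic distance by at most `1`. [cite: SeilerLNP1982, Ch. 2] -/
theorem finCycDist_finRotate_le {m : ℕ} (a b : Fin m) : finCycDist (finRotate m a) b ≤ finCycDist a b + 1 := by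
  have ha := a.isLt; have hb := b.isLt
  have hv := val_finRotate a
  unfold finCycDist
  split_ifs at hv <;> omega

/-- One step of `finRotate` decreases the cyclic distance by at most `1`. [cite: SeilerLNP1982, Ch. 2] -/
theorem finCycDist_le_finRotate {m : ℕ} (a b : Fin m) : finCycDist a b ≤ finCycDist (finRotate m a) b + 1 := by
  have ha := a.isLt; have hb := b.isLt
  have hv := val_finRotate a
  unfold finCycDist
  split_ifs at hv <;> omega

/-- A point and its `finRotate` are at cyclic distance `≤ 1`. [cite: SeilerLNP1982, Ch. 2] -/
theorem finCycDist_finRotate_self_le {m : ℕ} (a : Fin m) : finCycDist (finRotate m a) a ≤ 1 := by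
  simpa [finCycDist_self] using finCycDist_finRotate_le a a

variable {n : ℕ}

/-- **The `2 : 1` fold** `Fin (2n) → Fin n`, `t ↦ t mod n` (the covering map of the cycle of length `2n` onto the cycle of length `n`).
[cite: SeilerLNP1982, Ch. 2] -/
def finFold (t : Fin (n + n)) : Fin n :=
  ⟨if (t : ℕ) < n then t else t - n, by have := t.isLt; split_ifs <;> omega⟩

/-- The value of the fold. [cite: SeilerLNP1982, Ch. 2] -/
theorem val_finFold (t : Fin (n + n)) : ((finFold t : Fin n) : ℕ) = if (t : ℕ) < n then (t : ℕ) else t - n := rfl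

/-- **The fold is a covering of cycle graphs**: it commutes with `finRotate`. [cite: SeilerLNP1982, Ch. 2] -/
theorem finFold_finRotate (t : Fin (n + n)) : finFold (finRotate (n + n) t) = finRotate n (finFold t) := by
  apply Fin.ext
  rw [val_finFold, val_finRotate, val_finRotate, val_finFold]
  have := t.isLt
  split_ifs <;> omega

/-- The fold does not increase cyclic distances. [cite: SeilerLNP1982, Ch. 2] -/
theorem finCycDist_finFold_le (t t' : Fin (n + n)) : finCycDist (finFold t) (finFold t') ≤ finCycDist t t' := by
  have h1 := t.isLt; have h2 := t'.isLt
  unfold finCycDist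
  rw [val_finFold, val_finFold]
  split_ifs <;> omega

/-- **The fold is injective on pairs at cyclic distance `< n`.** [cite: SeilerLNP1982, Ch. 2] -/
theorem eq_of_finFold_eq (t t' : Fin (n + n)) (h : finFold t = finFold t') (hd : finCycDist t t' < n) : t = t' := by
  have h1 := t.isLt; have h2 := t'.isLt
  have hv := congrArg Fin.val h
  rw [val_finFold, val_finFold] at hv
  apply Fin.ext
  unfold finCycDist at hd
  split_ifs at hv <;> omega

/-- **The local section of the fold near `t₀`**: of the two preimages `t₁`, `t₁ + n` of `t₁ : Fin n`, the one cyclically closer to `t₀`.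
[cite: SeilerLNP1982, Ch. 2] -/
def finLift (t₀ : Fin (n + n)) (t₁ : Fin n) : Fin (n + n) :=
  if finCycDist (⟨t₁, by have := t₁.isLt; omega⟩ : Fin (n + n)) t₀ ≤
      finCycDist (⟨t₁ + n, by have := t₁.isLt; omega⟩ : Fin (n + n)) t₀ then
    ⟨t₁, by have := t₁.isLt; omega⟩
  else ⟨t₁ + n, by have := t₁.isLt; omega⟩

/-- The value of the local section is one of the two preimages. [cite: SeilerLNP1982, Ch. 2] -/
theorem val_finLift (t₀ : Fin (n + n)) (t₁ : Fin n) :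
    ((finLift t₀ t₁ : Fin (n + n)) : ℕ) = t₁ ∨ ((finLift t₀ t₁ : Fin (n + n)) : ℕ) = t₁ + n := by
  unfold finLift
  split_ifs <;> simp

/-- The local section is a section of the fold. [cite: SeilerLNP1982, Ch. 2] -/
theorem finFold_finLift (t₀ : Fin (n + n)) (t₁ : Fin n) : finFold (finLift t₀ t₁) = t₁ := by
  have h1 := t₁.isLt
  apply Fin.ext
  rw [val_finFold]
  rcases val_finLift t₀ t₁ with h | h <;> rw [h] <;> split_ifs <;> omega

/-- The local section realises the folded cyclic distance: `dist(lift t₁, t₀) = dist(t₁, fold t₀)`. [cite: SeilerLNP1982, Ch. 2] -/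
theorem finCycDist_finLift (t₀ : Fin (n + n)) (t₁ : Fin n) :
    finCycDist (finLift t₀ t₁) t₀ = finCycDist t₁ (finFold t₀) := by
  have h0 := t₀.isLt; have h1 := t₁.isLt
  unfold finLift finCycDist
  simp only [val_finFold]
  split_ifs <;> simp only [] <;> omega

/-- The local section inverts the fold on the time ball of radius `< n/2` about `t₀`. [cite: SeilerLNP1982, Ch. 2] -/
theorem finLift_finFold (t₀ t : Fin (n + n)) (h : 2 * finCycDist t t₀ < n) : finLift t₀ (finFold t) = t := by
  have h0 := t₀.isLt; have h1 := t.isLt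
  apply Fin.ext
  unfold finLift
  unfold finCycDist at h ⊢
  simp only [val_finFold]
  split_ifs <;> simp only [] <;> omega


/-! ### The `2 : 1` time covering of 't Hooft boxes: `n₀ × n₁ × n₂ × 2n → n₀ × n₁ × n₂ × n` -/

variable {n₀ n₁ n₂ : ℕ}

/-- **The covering map on sites**: fold the time coordinate. [cite: SeilerLNP1982, Ch. 2] -/
def siteFold (x : FinTorusSite n₀ n₁ n₂ (n + n)) : FinTorusSite n₀ n₁ n₂ n := (x.1, x.2.1, x.2.2.1, finFold x.2.2.2)

/-- The covering map commutes with the shifts. [cite: SeilerLNP1982, Ch. 2] -/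
theorem siteFold_shift (x : FinTorusSite n₀ n₁ n₂ (n + n)) (μ : Fin 4) : siteFold (x.shift μ) = (siteFold x).shift μ := by
  fin_cases μ <;> simp [siteFold, FinTorusSite.shift, finFold_finRotate, -finRotate_apply]

/-- The covering map on links. [cite: SeilerLNP1982, Ch. 2] -/
def linkFold (l : FinTorusLink n₀ n₁ n₂ (n + n)) : FinTorusLink n₀ n₁ n₂ n := (siteFold l.1, l.2)

/-- The covering map on plaquettes. [cite: SeilerLNP1982, Ch. 2] -/
def plaqFold (q : FinTorusPlaquette n₀ n₁ n₂ (n + n)) : FinTorusPlaquette n₀ n₁ n₂ n := (siteFold q.1, q.2)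

/-- The covering map sends the links of a plaquette to the links of its image. [cite: SeilerLNP1982, Ch. 2] -/
theorem finTorusPlaqEdges_plaqFold (q : FinTorusPlaquette n₀ n₁ n₂ (n + n)) :
    finTorusPlaqEdges (plaqFold q) = (finTorusPlaqEdges q).image linkFold := by
  simp [finTorusPlaqEdges, plaqFold, linkFold, siteFold_shift, Finset.image_insert, Finset.image_singleton]

/-- The plaquette variable of a pulled-back configuration is the plaquette variable downstairs. [cite: SeilerLNP1982, Ch. 2] -/
theorem finTorusPlaquette_comp_linkFold {G : Type*} [Group G] (U₁ : FinTorusLink n₀ n₁ n₂ n → G)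
    (x : FinTorusSite n₀ n₁ n₂ (n + n)) (μ ν : Fin 4) :
    finTorusPlaquette (U₁ ∘ linkFold) x μ ν = finTorusPlaquette U₁ (siteFold x) μ ν := by
  simp [finTorusPlaquette, linkFold, siteFold_shift]

/-- **The local section on sites** near the time `t₀`. [cite: SeilerLNP1982, Ch. 2] -/
def siteLift (t₀ : Fin (n + n)) (x₁ : FinTorusSite n₀ n₁ n₂ n) : FinTorusSite n₀ n₁ n₂ (n + n) :=
  (x₁.1, x₁.2.1, x₁.2.2.1, finLift t₀ x₁.2.2.2)

/-- The local section on plaquettes. [cite: SeilerLNP1982, Ch. 2] -/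
def plaqLift (t₀ : Fin (n + n)) (q₁ : FinTorusPlaquette n₀ n₁ n₂ n) : FinTorusPlaquette n₀ n₁ n₂ (n + n) := (siteLift t₀ q₁.1, q₁.2)

/-- The plaquette section is a section of the plaquette fold. [cite: SeilerLNP1982, Ch. 2] -/
theorem plaqFold_plaqLift (t₀ : Fin (n + n)) (q₁ : FinTorusPlaquette n₀ n₁ n₂ n) : plaqFold (plaqLift t₀ q₁) = q₁ := by
  obtain ⟨⟨a, b, c, t⟩, pl⟩ := q₁
  simp [plaqFold, plaqLift, siteFold, siteLift, finFold_finLift]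

/-- The plaquette section inverts the plaquette fold on the time ball of radius `< n/2`. [cite: SeilerLNP1982, Ch. 2] -/
theorem plaqLift_plaqFold (t₀ : Fin (n + n)) (q : FinTorusPlaquette n₀ n₁ n₂ (n + n)) (h : 2 * finCycDist q.1.2.2.2 t₀ < n) :
    plaqLift t₀ (plaqFold q) = q := by
  obtain ⟨⟨a, b, c, t⟩, pl⟩ := q
  simp only [plaqFold, plaqLift, siteFold, siteLift, finLift_finFold t₀ t h]

/-- Heights: the time distance to `t₀` of a lifted plaquette is the folded time distance. [cite: SeilerLNP1982, Ch. 2] -/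
theorem finCycDist_plaqLift (t₀ : Fin (n + n)) (q₁ : FinTorusPlaquette n₀ n₁ n₂ n) :
    finCycDist (plaqLift t₀ q₁).1.2.2.2 t₀ = finCycDist q₁.1.2.2.2 (finFold t₀) := by
  simp [plaqLift, siteLift, finCycDist_finLift]

/-- Lattice-geometry plumbing for the time covering. [cite: SeilerLNP1982, Ch. 2] -/
theorem finCycDist_plaqFold_le (t₀ : Fin (n + n)) (q : FinTorusPlaquette n₀ n₁ n₂ (n + n)) :
    finCycDist (plaqFold q).1.2.2.2 (finFold t₀) ≤ finCycDist q.1.2.2.2 t₀ := by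
  simp [plaqFold, siteFold, finCycDist_finFold_le]

/-! ### Time coordinates along links -/

/-- A link of a plaquette sits at the plaquette's time or one step later. [cite: SeilerLNP1982, Ch. 2] -/
theorem time_of_mem_finTorusPlaqEdges {n₃ : ℕ} (q : FinTorusPlaquette n₀ n₁ n₂ n₃) {l : FinTorusLink n₀ n₁ n₂ n₃}
    (hl : l ∈ finTorusPlaqEdges q) : l.1.2.2.2 = q.1.2.2.2 ∨ l.1.2.2.2 = finRotate n₃ q.1.2.2.2 := by
  simp only [finTorusPlaqEdges, Finset.mem_insert, Finset.mem_singleton] at hl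
  have hshift : ∀ μ : Fin 4, (q.1.shift μ).2.2.2 = q.1.2.2.2 ∨ (q.1.shift μ).2.2.2 = finRotate n₃ q.1.2.2.2 := by
    intro μ
    fin_cases μ <;> simp [FinTorusSite.shift]
  rcases hl with rfl | rfl | rfl | rfl
  · exact Or.inl rfl
  · exact hshift _
  · exact hshift _
  · exact Or.inl rfl

/-- A link of a plaquette is within time distance `1` of it. [cite: SeilerLNP1982, Ch. 2] -/
theorem finCycDist_link_le_one {n₃ : ℕ} (q : FinTorusPlaquette n₀ n₁ n₂ n₃) {l : FinTorusLink n₀ n₁ n₂ n₃}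
    (hl : l ∈ finTorusPlaqEdges q) : finCycDist l.1.2.2.2 q.1.2.2.2 ≤ 1 := by
  rcases time_of_mem_finTorusPlaqEdges q hl with h | h
  · rw [h, finCycDist_self]; exact Nat.zero_le _
  · rw [h]; exact finCycDist_finRotate_self_le _

/-- **Two plaquettes sharing a link are within time distance `1`.** [cite: SeilerLNP1982, Ch. 2] -/
theorem finCycDist_le_one_of_linkRel {n₃ : ℕ} {G : Type*} [Group G] {q q' : FinTorusPlaquette n₀ n₁ n₂ n₃}
    (h : (finTorusSystem n₀ n₁ n₂ n₃ G).linkRel q q') : finCycDist q.1.2.2.2 q'.1.2.2.2 ≤ 1 := by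
  obtain ⟨l, hl, hl'⟩ := (finTorusSystem n₀ n₁ n₂ n₃ G).linkRel_iff.1 h
  rw [finTorusSystem_edges] at hl hl'
  rcases time_of_mem_finTorusPlaqEdges q hl with h1 | h1 <;>
    rcases time_of_mem_finTorusPlaqEdges q' hl' with h2 | h2
  · rw [← h1, h2, finCycDist_self]; exact Nat.zero_le _
  · rw [← h1, h2]; exact finCycDist_finRotate_self_le _
  · rw [← h2, h1, finCycDist_comm]; exact finCycDist_finRotate_self_le _
  · have : q.1.2.2.2 = q'.1.2.2.2 := (finRotate n₃).injective (h1.symm.trans h2)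
    rw [this, finCycDist_self]; exact Nat.zero_le _

/-- The time-distance height is `1`-Lipschitz along the link relation. [cite: SeilerLNP1982, Ch. 2] -/
theorem finCycDist_lipschitz_linkRel {n₃ : ℕ} {G : Type*} [Group G] (t₀ : Fin n₃) (q q' : FinTorusPlaquette n₀ n₁ n₂ n₃)
    (h : (finTorusSystem n₀ n₁ n₂ n₃ G).linkRel q q') : finCycDist q'.1.2.2.2 t₀ ≤ finCycDist q.1.2.2.2 t₀ + 1 := by
  have h1 := finCycDist_triangle q'.1.2.2.2 q.1.2.2.2 t₀
  have h2 := finCycDist_le_one_of_linkRel h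
  rw [finCycDist_comm] at h2
  omega

/-! ### Injectivity of the covering on time balls -/

/-- **Plaquettes within time distance `< R` of `t₀`, `2R < n`, are folded injectively.** [cite: SeilerLNP1982, Ch. 2] -/
theorem plaqFold_injOn_ball (t₀ : Fin (n + n)) {R : ℕ} (hR : 2 * R < n) {q q' : FinTorusPlaquette n₀ n₁ n₂ (n + n)}
    (hq : finCycDist q.1.2.2.2 t₀ < R) (hq' : finCycDist q'.1.2.2.2 t₀ < R) (h : plaqFold q = plaqFold q') : q = q' := by
  obtain ⟨⟨a, b, c, t⟩, pl⟩ := q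
  obtain ⟨⟨a', b', c', t'⟩, pl'⟩ := q'
  simp only [plaqFold, siteFold, Prod.mk.injEq] at h
  obtain ⟨⟨rfl, rfl, rfl, hft⟩, rfl⟩ := h
  have hd : finCycDist t t' < n := by
    have := finCycDist_triangle t t₀ t'
    rw [finCycDist_comm t₀ t'] at this
    simp only at hq hq'
    omega
  simp [eq_of_finFold_eq t t' hft hd]

/-- **Links of plaquettes within time distance `< R` of `t₀`, `2R < n`, are folded injectively.** [cite: SeilerLNP1982, Ch. 2] -/
theorem linkFold_injOn_ball (t₀ : Fin (n + n)) {R : ℕ} (hR : 2 * R < n) {q q' : FinTorusPlaquette n₀ n₁ n₂ (n + n)}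
    (hq : finCycDist q.1.2.2.2 t₀ < R) (hq' : finCycDist q'.1.2.2.2 t₀ < R) {l l' : FinTorusLink n₀ n₁ n₂ (n + n)}
    (hl : l ∈ finTorusPlaqEdges q) (hl' : l' ∈ finTorusPlaqEdges q') (h : linkFold l = linkFold l') : l = l' := by
  have h1 := finCycDist_link_le_one q hl
  have h2 := finCycDist_link_le_one q' hl'
  obtain ⟨⟨a, b, c, t⟩, μ⟩ := l
  obtain ⟨⟨a', b', c', t'⟩, μ'⟩ := l'
  simp only [linkFold, siteFold, Prod.mk.injEq] at h
  obtain ⟨⟨rfl, rfl, rfl, hft⟩, rfl⟩ := h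
  have hd : finCycDist t t' < n := by
    have e1 := finCycDist_triangle t q.1.2.2.2 t₀
    have e2 := finCycDist_triangle t t₀ q'.1.2.2.2
    have e3 := finCycDist_triangle t q'.1.2.2.2 t'
    rw [finCycDist_comm t₀ q'.1.2.2.2] at e2
    rw [finCycDist_comm q'.1.2.2.2 t'] at e3
    simp only at h1 h2
    omega
  simp [eq_of_finFold_eq t t' hft hd]

end Literature.MathematicalPhysics.QuantumFieldTheory

end

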